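import Literature.Computability.QuantumComplexity.GoldenArithmetic
import Literature.Computability.QuantumComplexity.PathModelRepresentation
import Mathlib.Analysis.SpecialFunctions.Complex.Circle
import HarnessLib

/-!
# Exact arithmetic in `ℤ[φ][ζ₅][√τ]`: the number ring of the `k = 5` path model

Topic `Literature/Computability/QuantumComplexity`; sequel of `GoldenArithmetic.lean` (`ZPhi = ℤ[φ]`,
`ZPhiS = ℤ[φ][√τ]`, real evaluations, decidable signs). Here the complex levels, again as Mathlib
`QuadraticAlgebra`s in coordinates (so that `decide` evaluates closed terms and a Turing machine
can mirror the arithmetic on integer codes):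

* `ZPhiZeta = QuadraticAlgebra ZPhi (-1) τ = ℤ[φ][ζ]/(ζ² - τζ + 1)` — since `ζ₅ + ζ₅⁻¹ = 2cos(2π/5)
  = τ = φ - 1`, the fifth root of unity is quadratic over `ℤ[φ]`; `ZPhiZeta.toComplex` (at
  `ζ₅ = e^{2πi/5}`), compatibility with complex conjugation (`star`, `conj ζ = τ - ζ`), the
  real-part and imaginary-part coordinate maps `re2 z = 2 Re z ∈ ℤ[φ]` (`2Re(u + vζ) = 2u + τv`) and
  `Im(u + vζ) = v · sin(2π/5)`, and injectivity;
* `K5 = QuadraticAlgebra ZPhiZeta (C τ) 0 = ℤ[φ][ζ₅][√τ]`, `K5.toComplex` (at `√τ`), complex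
  conjugation `K5.cconj` (coordinatewise `star`; NOT the `QuadraticAlgebra` star, which negates the
  real `√τ`), `re2`/`imC` into `ZPhiS` with `2 Re (toComplex z) = ZPhiS.toReal (re2 z)`,
  `Im (toComplex z) = ZPhiS.toReal (imC z) · sin(2π/5)`, and injectivity — so that EQUALITY of such
  complex numbers is decided on the sixteen integer coordinates and the SIGN of real parts /
  imaginary parts by `ZPhiS.pos`;
* **the constants of the AJL path model at `k = 5`** as elements of these rings, with proofs that
  they evaluate correctly: `ajlPoint 5 = ζ₅ = toComplex ζ` (`ajlPoint_five_eq_zeta5`,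
  `toComplex_zeta`), and the weight ratios of AJL eq. (3.1) at the vertices
  `1, 2` of `G_5`: `λ₂/λ₁ = φ`, `λ₁/λ₂ = τ`, `λ₃/λ₂ = 1`, `√(λ₃λ₁)/λ₂ = √τ` (`λ_ℓ = sin(πℓ/5)`;
  Mathlib `Real.cos_pi_div_five`; `d = φ` is `ajlLoopValue_five_eq_goldenRatio` of
  `JonesLocalGateCircuit.lean`, not repeated here).

No statements of results beyond these algebraic/trigonometric facts are introduced; everything is
proved.

## References

* D. Aharonov, V. Jones, Z. Landau, Algorithmica 55 (2009); arXiv:quant-ph/0511096, §2.13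
  (`A = ie^{-iπ/2k}`), §3.1 eq. (3.1) (`λ_ℓ = sin(πℓ/k)`) [AharonovJonesLandau2009].
* D. Aharonov, I. Arad, New J. Phys. 13 (2011) 035019, Thm. 3.2 [AharonovArad2011].
* L. C. Washington, *Introduction to Cyclotomic Fields*, GTM 83, §2 (`ℚ(ζ₅) ⊃ ℚ(√5)`,
  `ζ + ζ⁻¹ = 2cos(2π/5)`) [folklore].
-/

noncomputable section

namespace Literature.Computability.QuantumComplexity

open QuadraticAlgebra Complex

/-! ### Trigonometry at `π/5` -/

section Trig

open Real

/-- `cos(2π/5) = (φ - 1)/2 = (√5 - 1)/4` (double angle from Mathlib's `cos(π/5) = (1 + √5)/4`).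
[folklore] -/
theorem cos_two_pi_div_five_eq : Real.cos (2 * π / 5) = (goldenRatio - 1) / 2 := by
  have h : 2 * π / 5 = 2 * (π / 5) := by ring
  rw [h, Real.cos_two_mul, Real.cos_pi_div_five, goldenRatio]
  have h5 : Real.sqrt 5 ^ 2 = 5 := Real.sq_sqrt (by norm_num)
  nlinarith [h5]

/-- `0 < sin(2π/5)`. [folklore] -/
theorem sin_two_pi_div_five_pos : 0 < Real.sin (2 * π / 5) :=
  Real.sin_pos_of_pos_of_lt_pi (by positivity) (by linarith [Real.pi_pos])

/-- `0 < sin(π/5)`. [folklore] -/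
theorem sin_pi_div_five_pos : 0 < Real.sin (π / 5) :=
  Real.sin_pos_of_pos_of_lt_pi (by positivity) (by linarith [Real.pi_pos])

/-- `sin(2π/5) = φ · sin(π/5)` (`sin 2x = 2 sin x cos x`, `2cos(π/5) = φ`). [folklore] -/
theorem sin_two_pi_div_five_eq : Real.sin (2 * π / 5) = goldenRatio * Real.sin (π / 5) := by
  have h : 2 * π / 5 = 2 * (π / 5) := by ring
  rw [h, Real.sin_two_mul, Real.cos_pi_div_five, goldenRatio]
  ring

end Trig

/-! ### `ℤ[φ][ζ₅]` -/

/-- **`ℤ[φ][ζ₅] = ℤ[φ][ζ]/(ζ² - τζ + 1)`** in coordinates `u + vζ`, `u, v ∈ ℤ[φ]` (Mathlib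
`QuadraticAlgebra ZPhi (-1) τ`, `ζ² = -1 + τζ`). [folklore] -/
abbrev ZPhiZeta : Type := QuadraticAlgebra ZPhi (-1) ZPhi.tau

namespace ZPhiZeta

open Real

/-- The fifth root of unity `ζ = 0 + 1·ζ`. [folklore] -/
def zeta : ZPhiZeta := ⟨0, 1⟩

/-- Coordinates of `ζ`. [folklore] -/
@[simp] theorem zeta_re : zeta.re = 0 := rfl
/-- Coordinates of `ζ`. [folklore] -/
@[simp] theorem zeta_im : zeta.im = 1 := rfl

/-- The complex number `ζ₅ = e^{2πi/5}`. [folklore] -/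
def zeta5 : ℂ := Complex.exp (2 * Real.pi * I / 5)

/-- `ζ₅ = cos(2π/5) + i sin(2π/5)`. [folklore] -/
theorem zeta5_eq : zeta5 = (Real.cos (2 * Real.pi / 5) : ℂ) + (Real.sin (2 * Real.pi / 5) : ℂ) * I := by
  rw [zeta5, show 2 * (Real.pi : ℂ) * I / 5 = ((2 * Real.pi / 5 : ℝ) : ℂ) * I by push_cast; ring,
    Complex.exp_mul_I, ← Complex.ofReal_cos, ← Complex.ofReal_sin]

/-- `Re ζ₅ = (φ - 1)/2`. [folklore] -/
theorem zeta5_re : zeta5.re = (goldenRatio - 1) / 2 := by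
  rw [zeta5_eq]
  simp only [Complex.add_re, Complex.ofReal_re, Complex.mul_re, Complex.I_re, Complex.I_im,
    Complex.ofReal_im, mul_zero, zero_mul, sub_zero, add_zero, cos_two_pi_div_five_eq]

/-- `Im ζ₅ = sin(2π/5)`. [folklore] -/
theorem zeta5_im : zeta5.im = Real.sin (2 * Real.pi / 5) := by
  rw [zeta5_eq]
  simp only [Complex.add_im, Complex.ofReal_im, Complex.mul_im, Complex.I_re, Complex.I_im,
    Complex.ofReal_re, mul_one, mul_zero, add_zero, zero_add]

/-- `conj ζ₅ = cos(2π/5) - i sin(2π/5)`. [folklore] -/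
theorem conj_zeta5 : starRingEnd ℂ zeta5 =
    (Real.cos (2 * Real.pi / 5) : ℂ) - (Real.sin (2 * Real.pi / 5) : ℂ) * I := by
  rw [zeta5_eq, map_add, map_mul, Complex.conj_ofReal, Complex.conj_ofReal, Complex.conj_I]
  ring

/-- `|ζ₅|² = 1` in the form `ζ₅ · conj ζ₅ = 1`. [folklore] -/
theorem zeta5_mul_conj : zeta5 * starRingEnd ℂ zeta5 = 1 := by
  rw [conj_zeta5, zeta5_eq]
  have h : (Real.cos (2 * Real.pi / 5) : ℂ) ^ 2 + (Real.sin (2 * Real.pi / 5) : ℂ) ^ 2 = 1 := by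
    exact_mod_cast Real.cos_sq_add_sin_sq (2 * Real.pi / 5)
  have hI : (I : ℂ) * I = -1 := Complex.I_mul_I
  linear_combination h - ((Real.sin (2 * Real.pi / 5) : ℂ)) ^ 2 * hI

/-- `ζ₅ + conj ζ₅ = φ - 1 (= τ = 2cos(2π/5))`. [folklore] -/
theorem zeta5_add_conj : zeta5 + starRingEnd ℂ zeta5 = ((goldenRatio - 1 : ℝ) : ℂ) := by
  rw [conj_zeta5, zeta5_eq, cos_two_pi_div_five_eq]
  push_cast
  ring

/-- **`ζ₅` is quadratic over `ℤ[φ]`**: `ζ₅² = -1 + (φ - 1) ζ₅` (`ζ² - (ζ + ζ̄)ζ + ζζ̄ = 0`).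
[folklore] -/
theorem zeta5_mul_zeta5 : zeta5 * zeta5 = -1 + ((goldenRatio - 1 : ℝ) : ℂ) * zeta5 := by
  rw [← zeta5_add_conj]
  linear_combination -zeta5_mul_conj

/-- **Evaluation `ℤ[φ][ζ₅] → ℂ`** at `ζ₅ = e^{2πi/5}`, along `ℤ[φ] → ℝ → ℂ`. [folklore] -/
def toComplex : ZPhiZeta →+* ℂ :=
  QuadraticAlgebra.liftHom (Complex.ofRealHom.comp ZPhi.toReal) zeta5 (by
    simp only [RingHom.coe_comp, Function.comp_apply, Complex.ofRealHom_eq_coe, map_neg, map_one,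
      ZPhi.toReal_tau]
    push_cast
    have := zeta5_mul_zeta5
    push_cast at this
    exact this)

/-- `toComplex` applied. [folklore] -/
theorem toComplex_apply (z : ZPhiZeta) :
    toComplex z = (ZPhi.toReal z.re : ℂ) + (ZPhi.toReal z.im : ℂ) * zeta5 := rfl

/-- `toComplex ζ = ζ₅`. [folklore] -/
theorem toComplex_zeta : toComplex zeta = zeta5 := by
  rw [toComplex_apply, zeta_re, zeta_im, map_zero, map_one]; push_cast; ring

/-- **Compatibility with complex conjugation**: the `QuadraticAlgebra` star (`ζ ↦ τ - ζ`) is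
carried to `conj` (`conj ζ₅ = ζ₅⁻¹ = τ - ζ₅`). [folklore] -/
theorem toComplex_star (z : ZPhiZeta) : toComplex (star z) = starRingEnd ℂ (toComplex z) := by
  have hc : starRingEnd ℂ zeta5 = ((goldenRatio - 1 : ℝ) : ℂ) - zeta5 := by
    rw [← zeta5_add_conj]; ring
  rw [toComplex_apply, toComplex_apply, re_star, im_star, map_add, map_mul, map_neg, ZPhi.toReal_tau,
    map_add, map_mul, Complex.conj_ofReal, Complex.conj_ofReal, hc]
  push_cast
  ring

/-- Twice the real part, in coordinates: `2 Re(u + vζ) = 2u + τv ∈ ℤ[φ]`. [folklore] -/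
def re2 (z : ZPhiZeta) : ZPhi := 2 * z.re + ZPhi.tau * z.im

/-- **Real parts are read off exactly**: `2 Re (toComplex z) = ZPhi.toReal (re2 z)`. [folklore] -/
theorem two_mul_re_toComplex (z : ZPhiZeta) : 2 * (toComplex z).re = ZPhi.toReal (re2 z) := by
  rw [toComplex_apply, re2, map_add, map_mul, map_mul, ZPhi.toReal_tau, map_ofNat]
  simp [zeta5_re]
  ring

/-- **Imaginary parts are read off exactly**: `Im (toComplex z) = ZPhi.toReal z.im · sin(2π/5)`.
[folklore] -/
theorem im_toComplex (z : ZPhiZeta) : (toComplex z).im = ZPhi.toReal z.im * Real.sin (2 * Real.pi / 5) := by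
  rw [toComplex_apply]
  simp [zeta5_im]

/-- `toComplex` is injective: equality in `ℂ` is decided on the four integer coordinates.
[folklore] -/
theorem toComplex_injective : Function.Injective toComplex := by
  refine QuadraticAlgebra.liftHom_injective _ fun u v h => ?_
  have hc := h
  simp only [RingHom.coe_comp, Function.comp_apply, Complex.ofRealHom_eq_coe] at hc
  -- imaginary part: `toReal v · sin(2π/5) = 0`
  have him := congrArg Complex.im hc
  simp only [Complex.add_im, Complex.ofReal_im, Complex.mul_im, Complex.ofReal_re, zeta5_im,
    zero_add, Complex.zero_im, zeta5_re, zero_mul, add_zero] at him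
  have hv : ZPhi.toReal v = 0 := by
    rcases mul_eq_zero.1 him with h | h
    · exact h
    · exact absurd h sin_two_pi_div_five_pos.ne'
  have hv0 : v = 0 := ZPhi.toReal_injective (by rw [hv, map_zero])
  subst hv0
  have hre := congrArg Complex.re hc
  simp only [map_zero, Complex.ofReal_zero, zero_mul, add_zero, Complex.ofReal_re, Complex.zero_re] at hre
  exact ⟨ZPhi.toReal_injective (by rw [hre, map_zero]), rfl⟩

/-- `toComplex x = toComplex y ↔ x = y`. [folklore] -/
theorem toComplex_inj {x y : ZPhiZeta} : toComplex x = toComplex y ↔ x = y := toComplex_injective.eq_iff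

end ZPhiZeta

/-! ### `ℤ[φ][ζ₅][√τ]` -/

/-- **`K5 = ℤ[φ][ζ₅][√τ] = ℤ[φ][ζ₅][s]/(s² - τ)`** in coordinates `x + y√τ`, `x, y ∈ ℤ[φ][ζ₅]`
(Mathlib `QuadraticAlgebra ZPhiZeta (C τ) 0`): the ring containing every entry of the `k = 5`
path-model matrices. [cite: AharonovJonesLandau2009, §3.1 eq. (3.1)] -/
abbrev K5 : Type := QuadraticAlgebra ZPhiZeta (QuadraticAlgebra.C ZPhi.tau) 0

namespace K5

open Real

/-- `√τ = 0 + 1·√τ`. [folklore] -/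
def sqrtTau : K5 := ⟨0, 1⟩

/-- The base change of `ℤ[φ][ζ₅]` into `K5`. [folklore] -/
def ofZeta (x : ZPhiZeta) : K5 := ⟨x, 0⟩

/-- `ζ` as an element of `K5`. [folklore] -/
def zeta : K5 := ofZeta ZPhiZeta.zeta

/-- **Evaluation `K5 → ℂ`** at `√τ = √(φ - 1)`. [folklore] -/
def toComplex : K5 →+* ℂ :=
  QuadraticAlgebra.liftHom ZPhiZeta.toComplex (ZPhiS.sqrtTau : ℂ) (by
    rw [map_zero, zero_mul, add_zero, ZPhiZeta.toComplex_apply, QuadraticAlgebra.C]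
    simp only [map_zero, Complex.ofReal_zero, zero_mul, add_zero, ZPhi.toReal_tau]
    rw [← Complex.ofReal_mul, ZPhiS.sqrtTau_mul_self])

/-- `toComplex` applied. [folklore] -/
theorem toComplex_apply (z : K5) :
    toComplex z = ZPhiZeta.toComplex z.re + ZPhiZeta.toComplex z.im * (ZPhiS.sqrtTau : ℂ) := rfl

/-- `toComplex (ofZeta x) = ZPhiZeta.toComplex x`. [folklore] -/
@[simp] theorem toComplex_ofZeta (x : ZPhiZeta) : toComplex (ofZeta x) = ZPhiZeta.toComplex x := by
  rw [toComplex_apply, ofZeta]; simp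

/-- `toComplex √τ = √τ`. [folklore] -/
theorem toComplex_sqrtTau : toComplex sqrtTau = (ZPhiS.sqrtTau : ℂ) := by
  rw [toComplex_apply, sqrtTau]; simp

/-- `toComplex ζ = ζ₅`. [folklore] -/
theorem toComplex_zeta : toComplex zeta = ZPhiZeta.zeta5 := by
  rw [zeta, toComplex_ofZeta, ZPhiZeta.toComplex_zeta]

/-- **Complex conjugation on `K5`**: conjugate both `ℤ[φ][ζ₅]`-coordinates (`√τ` is real).
[folklore] -/
def cconj (z : K5) : K5 := ⟨star z.re, star z.im⟩

/-- `toComplex (cconj z) = conj (toComplex z)`. [folklore] -/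
theorem toComplex_cconj (z : K5) : toComplex (cconj z) = starRingEnd ℂ (toComplex z) := by
  rw [toComplex_apply, toComplex_apply, cconj]
  simp only [ZPhiZeta.toComplex_star, map_add, map_mul, Complex.conj_ofReal]

/-- Twice the real part, in coordinates: `re2 (x + y√τ) = re2 x + (re2 y) √τ ∈ ℤ[φ][√τ]`.
[folklore] -/
def re2 (z : K5) : ZPhiS := ⟨ZPhiZeta.re2 z.re, ZPhiZeta.re2 z.im⟩

/-- The imaginary-part coordinate: `imC (x + y√τ) = x.im + y.im √τ ∈ ℤ[φ][√τ]`
(`Im = (toReal ·) · sin(2π/5)`). [folklore] -/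
def imC (z : K5) : ZPhiS := ⟨z.re.im, z.im.im⟩

/-- **Real parts are read off exactly**: `2 Re (toComplex z) = ZPhiS.toReal (re2 z)`. [folklore] -/
theorem two_mul_re_toComplex (z : K5) : 2 * (toComplex z).re = ZPhiS.toReal (re2 z) := by
  rw [toComplex_apply, re2, ZPhiS.toReal_apply]
  simp only [Complex.add_re, Complex.mul_re, Complex.ofReal_re, Complex.ofReal_im, mul_zero, sub_zero]
  rw [← ZPhiZeta.two_mul_re_toComplex, ← ZPhiZeta.two_mul_re_toComplex]
  ring

/-- **Imaginary parts are read off exactly**: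
`Im (toComplex z) = ZPhiS.toReal (imC z) · sin(2π/5)`. [folklore] -/
theorem im_toComplex (z : K5) : (toComplex z).im = ZPhiS.toReal (imC z) * Real.sin (2 * Real.pi / 5) := by
  rw [toComplex_apply, imC, ZPhiS.toReal_apply]
  simp only [Complex.add_im, Complex.mul_im, Complex.ofReal_re, Complex.ofReal_im, mul_zero,
    ZPhiZeta.im_toComplex]
  ring

/-- `toComplex` is injective: equality in `ℂ` is decided on the sixteen integer coordinates.
[folklore] -/
theorem toComplex_injective : Function.Injective toComplex := by
  intro x y h
  have hre := congrArg (fun w : ℂ => 2 * w.re) h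
  have him := congrArg Complex.im h
  simp only [two_mul_re_toComplex] at hre
  rw [im_toComplex, im_toComplex] at him
  have him' : ZPhiS.toReal (imC x) = ZPhiS.toReal (imC y) :=
    mul_right_cancel₀ sin_two_pi_div_five_pos.ne' him
  have e1 := ZPhiS.toReal_injective hre
  have e2 := ZPhiS.toReal_injective him'
  simp only [re2, imC, QuadraticAlgebra.mk.injEq, ZPhiZeta.re2] at e1 e2
  obtain ⟨⟨xr, xi⟩, ⟨yr, yi⟩⟩ := x
  obtain ⟨⟨xr', xi'⟩, ⟨yr', yi'⟩⟩ := y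
  simp only at e1 e2
  obtain ⟨h1, h2⟩ := e1
  obtain ⟨rfl, rfl⟩ := e2
  have h1' : (2 : ZPhi) * xr = 2 * xr' := add_right_cancel h1
  have h2' : (2 : ZPhi) * yr = 2 * yr' := add_right_cancel h2
  have hxr : xr = xr' := by
    have a1 := congrArg QuadraticAlgebra.re h1'
    have a2 := congrArg QuadraticAlgebra.im h1'
    simp only [QuadraticAlgebra.re_mul, QuadraticAlgebra.im_mul, QuadraticAlgebra.re_ofNat,
      QuadraticAlgebra.im_ofNat] at a1 a2
    ext <;> omega
  have hyr : yr = yr' := by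
    have a1 := congrArg QuadraticAlgebra.re h2'
    have a2 := congrArg QuadraticAlgebra.im h2'
    simp only [QuadraticAlgebra.re_mul, QuadraticAlgebra.im_mul, QuadraticAlgebra.re_ofNat,
      QuadraticAlgebra.im_ofNat] at a1 a2
    ext <;> omega
  subst hxr; subst hyr; rfl

/-- `toComplex x = toComplex y ↔ x = y`. [folklore] -/
theorem toComplex_inj {x y : K5} : toComplex x = toComplex y ↔ x = y := toComplex_injective.eq_iff

/-- **Sign of the real part, decided**: `0 < Re (toComplex z) ↔ ZPhiS.pos (re2 z)`. [folklore] -/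
theorem re_toComplex_pos_iff (z : K5) : 0 < (toComplex z).re ↔ ZPhiS.pos (re2 z) = true := by
  rw [ZPhiS.pos_iff, ← two_mul_re_toComplex]
  constructor <;> intro h <;> linarith

/-- **Sign of the imaginary part, decided**: `0 < Im (toComplex z) ↔ ZPhiS.pos (imC z)`. [folklore] -/
theorem im_toComplex_pos_iff (z : K5) : 0 < (toComplex z).im ↔ ZPhiS.pos (imC z) = true := by
  rw [ZPhiS.pos_iff, im_toComplex]
  constructor
  · intro h
    by_contra hc
    push Not at hc
    have := mul_nonpos_of_nonpos_of_nonneg hc sin_two_pi_div_five_pos.le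
    linarith
  · intro h; exact mul_pos h sin_two_pi_div_five_pos

end K5

/-! ### The constants of the `k = 5` path model -/

section Constants

open Real

/-- **`A_5 = i e^{-iπ/10} = e^{2πi/5} = ζ₅`.** [cite: AharonovJonesLandau2009, §2.13] -/
theorem ajlPoint_five_eq_zeta5 : ajlPoint 5 = ZPhiZeta.zeta5 := by
  calc ajlPoint 5 = Complex.exp (Real.pi / 2 * I) * Complex.exp (-(Real.pi / (2 * (5 : ℕ)) : ℝ) * I) := by
        rw [Complex.exp_pi_div_two_mul_I]; rfl
    _ = ZPhiZeta.zeta5 := by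
        rw [← Complex.exp_add, ZPhiZeta.zeta5]
        congr 1
        push_cast
        ring

/-- `A_5 = toComplex ζ` (the crossing phase is an element of `K5`). [cite: AharonovJonesLandau2009, §2.13] -/
theorem ajlPoint_five_eq_toComplex : ajlPoint 5 = K5.toComplex K5.zeta := by
  rw [K5.toComplex_zeta, ajlPoint_five_eq_zeta5]

/-- `λ₁ = sin(π/5)`. [cite: AharonovJonesLandau2009, §3.1] -/
theorem ajlWeight_five_one : ajlWeight 5 1 = Real.sin (Real.pi / 5) := by
  rw [ajlWeight_of_mem (by norm_num)]; congr 1; push_cast; ring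

/-- `λ₂ = sin(2π/5)`. [cite: AharonovJonesLandau2009, §3.1] -/
theorem ajlWeight_five_two : ajlWeight 5 2 = Real.sin (2 * Real.pi / 5) := by
  rw [ajlWeight_of_mem (by norm_num)]; congr 1; push_cast; ring

/-- `λ₃ = sin(3π/5) = sin(2π/5) = λ₂`. [cite: AharonovJonesLandau2009, §3.1] -/
theorem ajlWeight_five_three : ajlWeight 5 3 = ajlWeight 5 2 := by
  rw [ajlWeight_of_mem (by norm_num), ajlWeight_five_two,
    show Real.pi * ((3 : ℤ) : ℝ) / ((5 : ℕ) : ℝ) = Real.pi - 2 * Real.pi / 5 by push_cast; ring, Real.sin_pi_sub]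

/-- `0 < λ₂`. [cite: AharonovJonesLandau2009, Claim 2.6] -/
theorem ajlWeight_five_two_pos : 0 < ajlWeight 5 2 := by
  rw [ajlWeight_five_two]; exact sin_two_pi_div_five_pos

/-- **`λ₂/λ₁ = φ`** (the `Φ`-eigenvalue on a block boundary, `d`). [cite: AharonovJonesLandau2009, §3.1 eq. (3.1)] -/
theorem ajlWeight_five_two_div_one : ajlWeight 5 2 / ajlWeight 5 1 = goldenRatio := by
  rw [ajlWeight_five_two, ajlWeight_five_one, sin_two_pi_div_five_eq, mul_div_assoc,
    div_self sin_pi_div_five_pos.ne', mul_one]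

/-- **`λ₁/λ₂ = τ = φ - 1`.** [cite: AharonovJonesLandau2009, §3.1 eq. (3.1)] -/
theorem ajlWeight_five_one_div_two : ajlWeight 5 1 / ajlWeight 5 2 = goldenRatio - 1 := by
  have hs : Real.sin (Real.pi / 5) ≠ 0 := sin_pi_div_five_pos.ne'
  rw [ajlWeight_five_two, ajlWeight_five_one, sin_two_pi_div_five_eq, mul_comm goldenRatio, ← div_div,
    div_self hs, one_div, inv_goldenRatio]
  linarith [goldenRatio_add_goldenConj]

/-- **`λ₃/λ₂ = 1`.** [cite: AharonovJonesLandau2009, §3.1 eq. (3.1)] -/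
theorem ajlWeight_five_three_div_two : ajlWeight 5 3 / ajlWeight 5 2 = 1 := by
  rw [ajlWeight_five_three, div_self ajlWeight_five_two_pos.ne']

/-- **`√(λ₃ λ₁)/λ₂ = √τ`** (the off-diagonal entry of `Φ` at vertex `2`).
[cite: AharonovJonesLandau2009, §3.1 eq. (3.1)] -/
theorem sqrt_ajlWeight_five_three_mul_one_div_two :
    Real.sqrt (ajlWeight 5 3 * ajlWeight 5 1) / ajlWeight 5 2 = ZPhiS.sqrtTau := by
  have h2 := ajlWeight_five_two_pos
  have hnn : 0 ≤ Real.sqrt (ajlWeight 5 3 * ajlWeight 5 1) / ajlWeight 5 2 := by positivity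
  have key : (Real.sqrt (ajlWeight 5 3 * ajlWeight 5 1) / ajlWeight 5 2) ^ 2 = goldenRatio - 1 := by
    rw [div_pow, Real.sq_sqrt (mul_nonneg (ajlWeight_nonneg _ _) (ajlWeight_nonneg _ _)),
      ajlWeight_five_three, ← ajlWeight_five_one_div_two]
    field_simp
  rw [ZPhiS.sqrtTau, ← key, Real.sqrt_sq hnn]

end Constants

end Literature.Computability.QuantumComplexity

end
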